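import Summits.BirchSwinnertonDyer.Rank1Residual.AdditivePotMult.TwistPointsOver
import Literature.NumberTheory.EllipticCurves.VariableChangePointsMap
import Literature.NumberTheory.EllipticCurves.SupersingularTorsionDegreeBoundProofs
import Mathlib.FieldTheory.IntermediateField.Adjoin.Basic
import Mathlib.NumberTheory.Real.Irrational
import HarnessLib

/-!
# `W(ℚ_p)[p] = 0` for a quadratic twist `W` of a good supersingular curve, `p ≥ 3` — the
# hypothesis "`W(ℚ_p)` has no point of order `p`" of the quadratic-branch consumers DISCHARGED from
# a good supersingular `ℤ_p`-model of `V ≅ W^{(c)}` (cell `b2b-bsdres`, CLASS-CLOSURE lane, class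
# O10 — x1b GEN 32, class lead; file 7 of the local series, after p315764 / p316085 / p316474)

HONEST FRAMING (cell `b2b-bsdres`, run/shared/lean/b2b/bsd-rank1-residual/, verbatim in every
file): the goal of the cell is to DELETE the COMBINATION-SHAPED residual classes of the
Birch–Swinnerton-Dyer formula for ALL analytic-rank `≤ 1` elliptic curves over `ℚ` — "full BSD
formula for every rank `≤ 1` curve in class `C`" assembled STRICTLY from published theorems — so
that the rank-`≤ 1` remainder becomes exactly the CONSTRUCTION-SHAPED classes, which are TYPED
(missing-input `Prop`s), NOT attempted. This is not "finishing BSD". CLASS-CLOSURE lane: prove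
what is provable now; shrink each hard class to its core with data; no claim beyond stated classes;
research routes on CONSTRUCTION-SHAPED X12 / O10; census / instrument output = EVIDENCE / conjecture
items, NEVER a Literature fact; `RESIDUAL-MAP.md` marks change only by signed lines. THIS FILE:
TOOL THEOREMS ONLY (transport of the Literature degree bound along additive-p1's twist
substitution `twistPointEquivOver` and the tree's `VariableChange.pointEquivBaseChange`) — no
definition, no named Literature fact, no Summits-side fact `def`, no `sorry`, axioms standard;
nothing is booked; no label / mark / count / sub-cell moves; O10 stays OPEN / CONSTRUCTION-SHAPED;
nothing about `BSD(W, p)` of any pair is claimed.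

## What is proved

The typed inputs and consumers of the odd `η`-branch ((C3_η) `QuadraticBranchOddStrictExactControlOfPlusMCAt`,
(C2_η-GZ) `QuadraticBranchPAdicGrossZagierValuationAt`, `StrictSelmerIndex`, `QuadraticBranchOddStrictSelmerLevel`,
…) carry the hypothesis `∀ Q : (W.baseChange ℚ_[p]).toAffine.Point, p • Q = 0 → Q = 0` for the
additive curve `W` with `C • W.quadraticTwist (p*) = V`, `V` good supersingular at `p`. Here:

* `sq_ne_of_abs_eq_prime`, `not_mem_range_algebraMap_of_sq_eq` — `±p` (indeed any `c` with
  `|c| = p`) is not a rational square; a square root of a non-square `c` in a `ℚ`-field is not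
  rational.
* **`eq_zero_of_prime_smul_eq_zero_padic_of_quadraticTwist`** — for `p ≠ 2`, `c ∈ ℚ` not a square,
  `C • W.quadraticTwist c = V`, and a `ℤ_p`-model `M` of `V` with `Δ(M) ∈ ℤ_p^×`, `A_p(M) ∈ pℤ_p`
  (good SUPERSINGULAR) and `M ⊗ ℚ̄_p = V ⊗ ℚ̄_p`: **`W(ℚ_p)` has no point of order `p`.** Proof: a
  `p`-torsion `Q ∈ W(ℚ_p)` goes to `W(ℚ̄_p)`, then by the INVERSE twist substitution
  (`twistPointEquivOver`, additive-p1) to `W^{(c)}(ℚ̄_p)` and by `C` (`pointEquivBaseChange`) to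
  `V(ℚ̄_p)`; both substitutions are natural for `ℚ`-algebra maps fixing `√c`
  (`map_twistPointEquivOver`, `pointEquivBaseChange_map`), so the image is fixed by
  `Gal(ℚ̄_p/ℚ_p(√c))`, a subgroup of index `≤ 2 < (p² − 1)/2`; the Literature theorem
  `prime_smul_some_ne_zero_of_forall_apply_eq` (Serre 1972 §1.11 Prop. 12: the `x`-coordinate of
  a non-zero `p`-torsion point of `V(ℚ̄_p)` has degree `≥ (p² − 1)/2`) forces the image, hence `Q`,
  to be `0`.
* `eq_zero_of_prime_smul_eq_zero_padic_of_quadraticTwist_signedPrime` — the consumers' literal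
  twist parameter `c = (−1)^{p/2}·p`.

NOT here: producing `M` from the consumers' hypotheses `V.HasGoodReductionAtPrime p`,
`V.frobeniusTrace p = 0`, `V.IsGloballyMinimal` (the integral model `integralModelInt V` mapped to
`ℤ_p`, `p ∤ Δ`, and `a_p ≡ A_p (mod p)` = the tree's `intCast_frobeniusTrace_eq_hasseCoeff`) — a
separate bridge, successor target.

References: [SerreInventiones1972] §1.11 Prop. 12; [Kobayashi2003] Prop. 8.7 (p. 16);
[SilvermanAEC2009] X.2 Prop. 2.4, X.5 Cor. 5.4 (twists), III.1 (variable changes).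
-/

noncomputable section

open scoped Classical

namespace Summit.BirchSwinnertonDyer.Rank1Residual.Additive

open Literature.NumberTheory.EllipticCurves WeierstrassCurve
  Summit.BirchSwinnertonDyer.Rank1Residual.AdditivePotMult

/-! ## §1 Non-squares -/

/-- A rational number of absolute value a prime `p` is not a rational square (`√p` is irrational,
`Nat.Prime.irrational_sqrt`). [folklore] -/
theorem sq_ne_of_abs_eq_prime {p : ℕ} (hp : p.Prime) {c : ℚ} (hc : |c| = p) (q : ℚ) : q ^ 2 ≠ c := by
  intro h
  have hq : q ^ 2 = p := by
    have h1 : |q ^ 2| = (p : ℚ) := by rw [h, hc]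
    rwa [abs_of_nonneg (sq_nonneg q)] at h1
  have hirr := hp.irrational_sqrt
  have hsqrt : Real.sqrt p = |(q : ℝ)| := by
    rw [← Real.sqrt_sq_eq_abs]
    congr 1
    exact_mod_cast hq.symm
  rw [hsqrt] at hirr
  exact hirr ⟨|q|, by push_cast; rfl⟩

/-- `(−1)^k · p` is not a rational square. [folklore] -/
theorem sq_ne_neg_one_pow_mul_prime {p : ℕ} (hp : p.Prime) (k : ℕ) (q : ℚ) :
    q ^ 2 ≠ (-1) ^ k * p := by
  refine sq_ne_of_abs_eq_prime hp ?_ q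
  rw [abs_mul, abs_pow, abs_neg, abs_one, one_pow, one_mul, Nat.abs_cast]

/-- A square root `t` of a non-square rational `c` in a `ℚ`-algebra field is not rational.
[folklore] -/
theorem not_mem_range_algebraMap_of_sq_eq {A : Type*} [Field A] [Algebra ℚ A] {t : A} {c : ℚ}
    (htc : t ^ 2 = algebraMap ℚ A c) (hc : ∀ q : ℚ, q ^ 2 ≠ c) :
    t ∉ Set.range (algebraMap ℚ A) := by
  rintro ⟨q, rfl⟩
  apply hc q
  apply (algebraMap ℚ A).injective
  rw [map_pow, htc]

/-! ## §2 `W(ℚ_p)[p] = 0` for a quadratic twist of a good supersingular curve -/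

section Twist

variable {p : ℕ} [hp : Fact p.Prime]

/-- The index of `Gal(ℚ̄_p/ℚ_p(t))` for `t² ∈ ℚ_p` is `1` or `2`: non-zero and `< (p² − 1)/2` when
`p ≥ 3`. [folklore] -/
theorem index_fixingSubgroup_adjoin_sqrt_lt (hp2 : p ≠ 2) {t : AlgebraicClosure ℚ_[p]} {a : ℚ_[p]}
    (hta : t ^ 2 = algebraMap ℚ_[p] (AlgebraicClosure ℚ_[p]) a) :
    (IntermediateField.adjoin ℚ_[p] {t}).fixingSubgroup.index ≠ 0 ∧
      (IntermediateField.adjoin ℚ_[p] {t}).fixingSubgroup.index < (p ^ 2 - 1) / 2 := by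
  have hint : IsIntegral ℚ_[p] t := Algebra.IsIntegral.isIntegral t
  rw [← IntermediateField.finrank_eq_fixingSubgroup_index, IntermediateField.adjoin.finrank hint]
  refine ⟨(minpoly.natDegree_pos hint).ne', ?_⟩
  have hf0 : (Polynomial.X ^ 2 - Polynomial.C a : Polynomial ℚ_[p]) ≠ 0 :=
    Polynomial.X_pow_sub_C_ne_zero two_pos a
  have hft : Polynomial.aeval t (Polynomial.X ^ 2 - Polynomial.C a : Polynomial ℚ_[p]) = 0 := by
    rw [map_sub, map_pow, Polynomial.aeval_X, Polynomial.aeval_C, hta, sub_self]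
  have hdeg : (minpoly ℚ_[p] t).natDegree ≤ 2 := by
    have h := minpoly.degree_le_of_ne_zero ℚ_[p] t hf0 hft
    rw [Polynomial.degree_X_pow_sub_C two_pos] at h
    exact Polynomial.natDegree_le_iff_degree_le.mpr h
  have h3 : 3 ≤ p := by
    rcases hp.out.eq_two_or_odd' with h | h
    · exact absurd h hp2
    · have := hp.out.two_le; rcases h with ⟨k, hk⟩; omega
  have h9 : 9 ≤ p ^ 2 := by nlinarith
  omega

/-- **`W(ℚ_p)[p] = 0` for a quadratic twist `W` of a good supersingular curve, `p ≥ 3`.** Let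
`c ∈ ℚ` be a non-square, `C • W^{(c)} = V` (`W^{(c)} = W.quadraticTwist c`, `C` a variable change
over `ℚ`), and `M/ℤ_p` a model of `V` over `ℚ̄_p` (`M ⊗ ℚ̄_p = V ⊗ ℚ̄_p`) with `Δ(M) ∈ ℤ_p^×` and
`A_p(M) ∈ pℤ_p`. Then `W(ℚ_p)` has no point of order `p`: transport a `p`-torsion point to
`V(ℚ̄_p)` by the inverse twist substitution over `ℚ̄_p ∋ √c` and the variable change (both natural
in `ℚ`-algebra maps fixing `√c`), where it is fixed by `Gal(ℚ̄_p/ℚ_p(√c))` (index `≤ 2`), and apply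
Serre's degree bound `deg_{ℚ_p} x(P) ≥ (p² − 1)/2 > 2` (Literature
`prime_smul_some_ne_zero_of_forall_apply_eq`). [cite: SerreInventiones1972, §1.11 Prop. 12]
[cite: SilvermanAEC2009, X.5 Cor. 5.4] -/
theorem eq_zero_of_prime_smul_eq_zero_padic_of_quadraticTwist (hp2 : p ≠ 2)
    (W : WeierstrassCurve ℚ) {c : ℚ} (hc : ∀ q : ℚ, q ^ 2 ≠ c) (C : VariableChange ℚ)
    {V : WeierstrassCurve ℚ} (hCV : C • W.quadraticTwist c = V)
    (M : WeierstrassCurve ℤ_[p]) (hΔ : IsUnit M.Δ)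
    (hA : M.hasseCoeff p ∈ IsLocalRing.maximalIdeal ℤ_[p])
    (hVM : M.baseChange (AlgebraicClosure ℚ_[p]) = V.baseChange (AlgebraicClosure ℚ_[p])) :
    ∀ Q : (W.baseChange ℚ_[p]).toAffine.Point, p • Q = 0 → Q = 0 := by
  subst hCV
  intro Q hpQ
  obtain ⟨t, htc⟩ :=
    IsAlgClosed.exists_pow_nat_eq (algebraMap ℚ (AlgebraicClosure ℚ_[p]) c) two_pos
  have ht : t ∉ Set.range (algebraMap ℚ (AlgebraicClosure ℚ_[p])) :=
    not_mem_range_algebraMap_of_sq_eq htc hc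
  -- push `Q` to `ℚ̄_p`
  let f : ℚ_[p] →ₐ[ℚ] AlgebraicClosure ℚ_[p] := (Algebra.ofId ℚ_[p] _).restrictScalars ℚ
  have hinj := Affine.Point.map_injective (W' := W) f
  suffices hQA0 : Affine.Point.map f Q = 0 from hinj (hQA0.trans (map_zero _).symm)
  set QA := Affine.Point.map f Q with hQA
  have hpQA : p • QA = 0 := by rw [hQA, ← map_nsmul, hpQ, map_zero]
  -- transport to `V = C • W^{(c)}` over `ℚ̄_p`
  set Φ := twistPointEquivOver W ht htc with hΦ
  set Ψ := VariableChange.pointEquivBaseChange (W.quadraticTwist c) C (AlgebraicClosure ℚ_[p]) with hΨ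
  set P := Ψ (Φ.symm QA) with hP
  have hpP : p • P = 0 := by rw [hP, ← map_nsmul, ← map_nsmul, hpQA, map_zero, map_zero]
  -- `P` is fixed by `Gal(ℚ̄_p/ℚ_p(t))`
  set F : IntermediateField ℚ_[p] (AlgebraicClosure ℚ_[p]) := IntermediateField.adjoin ℚ_[p] {t}
    with hF
  have hfixP : ∀ σ ∈ F.fixingSubgroup,
      Affine.Point.map ((σ : AlgebraicClosure ℚ_[p] →ₐ[ℚ_[p]] AlgebraicClosure ℚ_[p]).restrictScalars ℚ)
        P = P := by
    intro σ hσ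
    set g := (σ : AlgebraicClosure ℚ_[p] →ₐ[ℚ_[p]] AlgebraicClosure ℚ_[p]).restrictScalars ℚ with hg
    have hgt : g t = t :=
      (IntermediateField.mem_fixingSubgroup_iff F σ).mp hσ t
        (IntermediateField.mem_adjoin_simple_self ℚ_[p] t)
    have hgf : g.comp f = f := by
      ext q
      exact σ.commutes q
    have hgQA : Affine.Point.map g QA = QA := by
      rw [hQA, Affine.Point.map_map, hgf]
    have hgΦ : Affine.Point.map g (Φ.symm QA) = Φ.symm QA := by
      have h := map_twistPointEquivOver W ht htc ht htc g hgt (Φ.symm QA)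
      rw [← hΦ, AddEquiv.apply_symm_apply, hgQA] at h
      -- h : QA = Φ (map g (Φ.symm QA))
      rw [(AddEquiv.eq_symm_apply Φ).mpr h.symm]
    rw [hP, VariableChange.pointEquivBaseChange_map, hgΦ]
  -- conclude with the degree bound on `V(ℚ̄_p)`
  rcases hPeq : P with _ | ⟨X, Y, hXY⟩
  · -- `P = 0` forces `QA = 0`
    have h1 : Φ.symm QA = 0 := by
      apply Ψ.injective
      rw [← hP, hPeq, map_zero]
      rfl
    have h2 : QA = Φ 0 := (AddEquiv.symm_apply_eq Φ).mp h1
    rw [h2, map_zero]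
  · exfalso
    have hfixX : ∀ σ ∈ F.fixingSubgroup, σ X = X := by
      intro σ hσ
      have h := hfixP σ hσ
      rw [hPeq, Affine.Point.map_some] at h
      exact (Affine.Point.some.inj h).1
    obtain ⟨hH0, hH⟩ := index_fixingSubgroup_adjoin_sqrt_lt hp2
      (a := algebraMap ℚ ℚ_[p] c) (t := t)
      (by rw [htc, IsScalarTower.algebraMap_apply ℚ ℚ_[p] (AlgebraicClosure ℚ_[p])])
    rw [hPeq] at hpP
    exact prime_smul_some_ne_zero_of_forall_apply_eq hp2 M hΔ hA hVM F.fixingSubgroup hH0 hH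
      hfixX hpP

/-- **The consumers' twist parameter `c = (−1)^{p/2}·p = p*`**: for `p ≠ 2`,
`C • W.quadraticTwist ((−1)^{p/2} p) = V` and a good supersingular `ℤ_p`-model `M` of `V`
(`M ⊗ ℚ̄_p = V ⊗ ℚ̄_p`), **`W(ℚ_p)` has no point of order `p`** — the hypothesis
`∀ Q : (W.baseChange ℚ_[p]).toAffine.Point, p • Q = 0 → Q = 0` of the (C2_η-GZ)/(C3_η) typed
inputs and of their consumers, discharged from the model. [cite: SerreInventiones1972, §1.11 Prop. 12]
[cite: Kobayashi2003, Prop. 8.7 (p. 16)] -/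
theorem eq_zero_of_prime_smul_eq_zero_padic_of_quadraticTwist_signedPrime (hp2 : p ≠ 2)
    (W : WeierstrassCurve ℚ) (C : VariableChange ℚ) {V : WeierstrassCurve ℚ}
    (hCV : C • W.quadraticTwist ((-1) ^ (p / 2) * p) = V)
    (M : WeierstrassCurve ℤ_[p]) (hΔ : IsUnit M.Δ)
    (hA : M.hasseCoeff p ∈ IsLocalRing.maximalIdeal ℤ_[p])
    (hVM : M.baseChange (AlgebraicClosure ℚ_[p]) = V.baseChange (AlgebraicClosure ℚ_[p])) :
    ∀ Q : (W.baseChange ℚ_[p]).toAffine.Point, p • Q = 0 → Q = 0 :=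
  eq_zero_of_prime_smul_eq_zero_padic_of_quadraticTwist hp2 W
    (sq_ne_neg_one_pow_mul_prime hp.out (p / 2)) C hCV M hΔ hA hVM

end Twist

end Summit.BirchSwinnertonDyer.Rank1Residual.Additive

end
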